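import Summits.ResolutionOfSingularities.ResolutionOfSingularities.Theorems.MarkedTransferCampaignW36SingRegularBridge
import Literature.AlgebraicGeometry.Hironaka2017.Proofs.S06BaseHike.Thm614Prop2ProdRegularCut
import HarnessLib

/-!
# [OURS · L1 W3.6 ↔ GAP-LEDGER R20 sub 20c / Th. 6.14 (2″)] THE A-TYPE BRIDGE: at the (43)-object `Ě`, «`Sing(Ě)` is an l.c.i. cut at each
# of its points» (the hypothesis `hci` of the D-lane's (56″) / Th. 6.14 (2″) kernels p496819 / p497160) IS the W3.6 class guard `LCIClass Ê Σ_max`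
# (p488503) — kernel `Iff` for every typed core focus; the class-restricted OURS Prop `CampaignW36.CoreFocusSingLCIOn 𝒞` + `p`-slice; and,
# UNCONDITIONALLY, «on the A-type class the (43)-object EXISTS and satisfies (56″) ∧ Th. 6.14 (2″) on every affine open»

Cell `res-hironaka` (run/shared/lean/pub/res-hironaka/), rung L (rescue), row L-G3, slot W3.6 (door PROVED p494780; A-type door p491140). Typed by
the OURS typer o4 (statement-only lane), companion of `Theorems/MarkedTransferCampaignW36SingRegularBridge.lean` (p498576: ⟨HatClosureRegular⟩ ⟺
⟨SingRegular(Ě)⟩, class `RegularClosureClass`). HOST (custody, no new route): `--supports stmt-ResolutionOfSingularities-16155 --as helper`.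

WHY (records on the cell's STATUS.md): the G3 lead (res-adj-3, WANTED → GO 2026-08-27T04:56:11Z, OPTIONAL rider) asked for a fifth Prop
«`CoreFocusSingLCIOn 𝒞` (⊋ SingRegular)» naming EXACTLY the regime of the D-lane kernels `S06BaseHike.Eq56_prod_ours_of_isCoreFocus_of_lci(Regular)`
(res-D-pv-026, `Proofs/S06BaseHike/Eq56ProdCoreFocusLCI.lean` p496819) and `Thm6_14_prop2_prod_ours_of_isCoreFocus_of_lci(Regular)` (res-D-pv-035,
`Proofs/S06BaseHike/Thm614Prop2ProdRegularCut.lean` p497160): «(56″) and Th. 6.14 (2″) hold at every typed core focus whose `Sing(Ě)` is STALKWISE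
L.C.I.». Their binder `hci : ∀ x ∈ ⟨Ě.sing, _⟩, ∃ rs, RingTheory.Sequence.IsRegular (𝒪_{Z,x}) rs ∧ Ideal.ofList rs = stalkIdeal (vanishingIdeal ⟨Ě.sing, _⟩) x`
is, literally, `∀ x ∈ Sing Ě, CampaignW36.IsLCICutAt ⟨Sing Ě⟩ x` (p488503's A-type point predicate), and `Sing(Ě) = Σ̄_max(Ê)` for every typed core
focus (p498576 §1). THIS FILE records:
* §1 `CampaignW36.lciClass_iff_forall_isLCICutAt_sing_of_isCoreFocus` — for EVERY typed core focus `Ě` of `Ê` (any reading `inv`, IsCoreFocus-STRUCTURE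
  form): `LCIClass Ê Σ_max(Ê) ↔ ∀ x ∈ Sing Ě, IsLCICutAt ⟨Sing Ě⟩ x`; hence BY NAME over p496819 / p497160: `eq56_prod_ours_of_lciClass`,
  `thm6_14_prop2_prod_ours_of_lciClass` — (56″) and Th. 6.14 (2″) on every affine `V` for EVERY typed core focus of ANY `(Ê, inv)` with `0 < Ê.b` whose
  top stratum is A-type (no standardness, no certification, no regularity of `Σ̄_max` needed).
* §2 OURS `CampaignW36.CoreFocusSingLCIOn 𝒞` (W3.6 idiom, predicate on `(A, E, ed)` guarded by `𝒞`, universally closed over the class — a HYPOTHESIS row,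
  never a modulus of record): «an `Ě` with `IsCoreFocus ℘ (invInst Ê ed) Ê Ě` EXISTS and `Sing(Ě)` is an l.c.i. cut at each of its points»;
  `coreFocusSingLCIOn_of_coreFocusSingRegularOn` (⟨SingRegular⟩ ⇒ ⟨SingLCI⟩, K-3a p497030); `coreFocusSingLCIOn_of_coreFocusExistsOn` (on data inside
  `LCIClass`, existence alone suffices); `eq56_thm614prop2_of_coreFocusSingLCIOn` (the two D-kernels fire on the class).
* §3 `p`-slice `CampaignW36CoreFocusSingLCIOnI 𝒞 p` and, UNCONDITIONALLY: `campaignW36CoreFocusSingLCIOnI_lci_holds p` (on `LCIClass` — door p491140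
  `campaignW36CoreFocusExists_lci_holds`), `campaignW36CoreFocusSingLCIOnI_regularClosure_holds p`, and the headline
  `campaignW36_eq56_thm614prop2_lci_holds p`: for every perfect `K`, ambient datum `A`, `n`, standard `E` with `0 < Ê.b`, certified `ed` with
  `LCIClass Ê Σ_max`, THERE IS a typed core focus `Ě` (instantiation of record) with `Eq56_prod_ours A Ě V ∧ Thm6_14_prop2_prod_ours A Ě V` for EVERY
  affine open `V` — i.e. at the (43)-object, 20c|(56″) and Th. 6.14 (2″) FOLLOW OUTRIGHT on `LCIClass`-data, whereas 20a (Th. 6.14 (1)) does so on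
  `RegularClosureClass`-data (p498576; SEAT 1 separates the two INSIDE `LCIClass`).

HONEST FRAMING. Every declaration below is OURS (a campaign statement about OUR typed objects) or kernel plumbing over typed carriers; NOTHING here
is a statement of H. Hironaka's manuscript (2017-03-23, [Hironaka2017], lit key `paper:url-3343fd9e678b`), nothing asserts that any statement of it
holds; «l.c.i.» / «regular sequence» hypotheses on `Sing(Ě)` are printed nowhere in §6 (pp. 29–34) — they are OUR class guards. `Eq56_prod_ours` /
`Thm6_14_prop2_prod_ours` are the OURS product READINGS (56″)/(2″) of rows 040g/040h (res-type-040), not the printed «∩» sentences (which are DNF as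
printed, p484016 / p490210). The typed candidates `IsCoreFocus(_inst)`, `baseHike`, `EdgeDataOn`, `IsEdgeDataOn`, `invField`/`invInst`,
`S04CharAlgebra.pAlg` are carriers / hypotheses only. AI typing, weaker than expert review.

## Vacuity self-check (T-lint; for the lanes)
* `CoreFocusSingLCIOn 𝒞` / `…OnI 𝒞 p`: NOT trivially true on a class with a member whose `Σ̄_max` is not an l.c.i. cut (e.g. B-type but not A-type:
  three concurrent axes, K3.6 specimen (B)); on `𝒞 ⊆ LCIClass` it HOLDS (this file) — there the content is the EXISTENCE theorem p491140 plus the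
  identity §1, disclosed; it demands an actual `Ě`. Vacuous exactly where the Hat family is (no standard `E` with `0 < Ê.b` in the class).
* The `Iff` of §1 is not definitional: it uses (43) + Jacobson density (`Sing(Ě) = closure Σ_max`, res-type-076) through p498576 §1.

Reference (context only, not a premise): H. Hironaka, ms. 2017-03-23, §6.2 p.30 l.4–9 Eq. (43); §6.3 Th. 6.14 (2) / Eq. (56) p.34 L16–L22. [Hironaka2017]
-/

noncomputable section

set_option linter.dupNamespace false -- mandated namespace of this single-conjunct summit

open _root_.AlgebraicGeometry _root_.TopologicalSpace

namespace Summit.ResolutionOfSingularities.ResolutionOfSingularities.Theorems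

open Literature.AlgebraicGeometry.Resolution Literature.AlgebraicGeometry.Hironaka2017
open Literature.AlgebraicGeometry.Hironaka2017.S02Preliminaries Literature.AlgebraicGeometry.Hironaka2017.S04CharAlgebra
open Literature.AlgebraicGeometry.Hironaka2017.S06BaseHike Literature.AlgebraicGeometry.Hironaka2017.Datum
open Scheme.IdealSheafData

universe u

namespace CampaignW36

/-! ## 1. Per instance: the A-type class guard IS the D-lane's `hci`, for every typed core focus (any reading `inv`) -/

section PerInstance

variable {p : ℕ} [Fact p.Prime] {K : Type u} [Field K] [CharP K p] {n : ℕ}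

/-- **`LCIClass Ê Σ_max(Ê) ↔ ∀ x ∈ Sing Ě, IsLCICutAt ⟨Sing Ě⟩ x`** for every typed core focusing `Ě` of `Ê` on the ambient datum, ANY reading
`inv` (IsCoreFocus-STRUCTURE form): the W3.6 A-type class guard (p488503) read at `(Ê, Σ_max)` IS the hypothesis `hci` of p496819 / p497160 (their
`IsRegular` variants, `IsLCICutAt` unfolded), because `closure Σ_max = Sing Ě` (res-type-076) / `Σ̄_max = ⟨Sing Ě⟩` in `Closeds` (p498576 §1).
Kernel plumbing over typed carriers; NOT a statement of the manuscript. [folklore] -/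
theorem lciClass_iff_forall_isLCICutAt_sing_of_isCoreFocus (A : AmbientDatum p K) (inv : IdealExponent A.Z → A.Z → EdgeInv n)
    (Ehat : IdealExponent A.Z) {Echeck : IdealExponent A.Z} (h : IsCoreFocus S04CharAlgebra.pAlg inv Ehat Echeck) :
    LCIClass Ehat (invmaxStratum (Ehat.sing ∩ S02Preliminaries.closedPoints A.Z) (inv Ehat)) ↔
      ∀ x ∈ Echeck.sing, IsLCICutAt (⟨Echeck.sing, A.isClosed_sing Echeck⟩ : Closeds A.Z) x := by
  have hcl : Closeds.closure (invmaxStratum (Ehat.sing ∩ S02Preliminaries.closedPoints A.Z) (inv Ehat)) =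
      (⟨Echeck.sing, A.isClosed_sing Echeck⟩ : Closeds A.Z) :=
    CampaignW31.invmaxClosure_eq_sing_of_isCoreFocus A inv Ehat h
  have hcl' : closure (invmaxStratum (Ehat.sing ∩ S02Preliminaries.closedPoints A.Z) (inv Ehat)) = Echeck.sing :=
    (sing_eq_closure_invmaxStratum_of_isCoreFocus A inv Ehat h).symm
  unfold LCIClass
  rw [hcl, hcl']

/-- `_inst` form (row 010d's instantiation of record `IsCoreFocus_inst Ê Ě ed`, reading `invField Ê ed`). Kernel plumbing; NOT a statement of the
manuscript. [folklore] -/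
theorem lciClass_iff_forall_isLCICutAt_sing_of_isCoreFocus_inst (A : AmbientDatum p K) (Ehat : IdealExponent A.Z)
    (ed : EdgeDataOn p n Ehat) {Echeck : IdealExponent A.Z} (h : IsCoreFocus_inst Ehat Echeck ed) :
    LCIClass Ehat (invmaxStratum (Ehat.sing ∩ S02Preliminaries.closedPoints A.Z) (invField Ehat ed)) ↔
      ∀ x ∈ Echeck.sing, IsLCICutAt (⟨Echeck.sing, A.isClosed_sing Echeck⟩ : Closeds A.Z) x :=
  lciClass_iff_forall_isLCICutAt_sing_of_isCoreFocus A (invInst Ehat ed) Ehat h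

/-- **(56″) ON THE A-TYPE CLASS, for EVERY typed core focus** (res-D-pv-026's `Eq56_prod_ours_of_isCoreFocus_of_lciRegular` p496819 BY NAME, its `hci`
supplied by §1): for ANY `(Ê, inv)` on the ambient datum with `0 < Ê.b` whose `Inv_max`-stratum is A-type (`LCIClass Ê Σ_max`), every `Ě` with
`IsCoreFocus ℘ inv Ê Ě` and every affine open `V`: `Eq56_prod_ours A Ě V` (row 040g's OURS product reading of Eq. (56)). No standardness, no certified
edge data, no regularity of `Σ̄_max`. Kernel composition; NOT a statement of the manuscript. [folklore] -/
theorem eq56_prod_ours_of_lciClass (A : AmbientDatum p K) (inv : IdealExponent A.Z → A.Z → EdgeInv n) (Ehat : IdealExponent A.Z)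
    (hd : 0 < Ehat.b) (hC : LCIClass Ehat (invmaxStratum (Ehat.sing ∩ S02Preliminaries.closedPoints A.Z) (inv Ehat)))
    {Echeck : IdealExponent A.Z} (h : IsCoreFocus S04CharAlgebra.pAlg inv Ehat Echeck) (V : A.Z.affineOpens) :
    Eq56_prod_ours A Echeck V :=
  Eq56_prod_ours_of_isCoreFocus_of_lciRegular A inv Ehat hd h
    (fun x hx => (lciClass_iff_forall_isLCICutAt_sing_of_isCoreFocus A inv Ehat h).mp hC x hx) V

/-- **Th. 6.14 (2″) ON THE A-TYPE CLASS, for EVERY typed core focus** (res-D-pv-035's `Thm6_14_prop2_prod_ours_of_isCoreFocus_of_lciRegular` p497160 BY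
NAME, `hci` from §1): same hypotheses, conclusion `Thm6_14_prop2_prod_ours A Ě V` (row 040h's OURS reading of Th. 6.14 (2) over (56″)). Kernel
composition; NOT a statement of the manuscript. [folklore] -/
theorem thm6_14_prop2_prod_ours_of_lciClass (A : AmbientDatum p K) (inv : IdealExponent A.Z → A.Z → EdgeInv n) (Ehat : IdealExponent A.Z)
    (hd : 0 < Ehat.b) (hC : LCIClass Ehat (invmaxStratum (Ehat.sing ∩ S02Preliminaries.closedPoints A.Z) (inv Ehat)))
    {Echeck : IdealExponent A.Z} (h : IsCoreFocus S04CharAlgebra.pAlg inv Ehat Echeck) (V : A.Z.affineOpens) :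
    Thm6_14_prop2_prod_ours A Echeck V :=
  Thm6_14_prop2_prod_ours_of_isCoreFocus_of_lciRegular A inv Ehat hd h
    (fun x hx => (lciClass_iff_forall_isLCICutAt_sing_of_isCoreFocus A inv Ehat h).mp hC x hx) V

end PerInstance

/-! ## 2. On a class `𝒞`: «`Ě` exists and `Sing(Ě)` is an l.c.i. cut at each of its points» -/

section OnClass

variable (𝒞 : ∀ ⦃W : Scheme.{u}⦄, IdealExponent W → Set W → Prop)
  (IsEdgeData : ∀ ⦃X : Scheme.{u}⦄ ⦃p n : ℕ⦄ (E : IdealExponent X) (ξ : X), EdgeDatumAt p n E ξ → Prop)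

/-- **[OURS · L1 W3.6 ↔ R20 20c/(2″)] `CampaignW36.CoreFocusSingLCIOn 𝒞` — «ON THE CLASS, THE (43)-OBJECT EXISTS AND ITS SINGULAR LOCUS IS AN
L.C.I. CUT AT EACH OF ITS POINTS»**: replaces the role of the unproved existence sentence p.30 l.5–9 TOGETHER WITH the unprinted A-type premise that
the D-lane's kernels for (56″) / Th. 6.14 (2″) consume (`hci` of p496819 / p497160); NOT a statement of the manuscript. A predicate on `(A, E, ed)`
guarded by `𝒞`, universally closed over the class — a HYPOTHESIS row, never a modulus of record (res-adj-3 04:56:11Z (R2)). Binders of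
`CoreFocusExistsOn 𝒞` (p487786): for every standard `E` with `0 < Ê.b`, every certified `ed`, if `𝒞 Ê Σ_max` then there IS an `Ě` with
`IsCoreFocus ℘ (invInst Ê ed) Ê Ě` such that `IsLCICutAt ⟨Ě.sing, A.isClosed_sing Ě⟩ x` at every `x ∈ Sing Ě`. Strictly WEAKER than
`CoreFocusSingRegularOn 𝒞` (p498576; `coreFocusSingLCIOn_of_coreFocusSingRegularOn`); HOLDS on every `𝒞 ⊆ LCIClass` (§3). [folklore] -/
def CoreFocusSingLCIOn {p : ℕ} [Fact p.Prime] {K : Type u} [Field K] [CharP K p] [PerfectField K] (A : AmbientDatum p K) (n : ℕ) :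
    Prop :=
  ∀ (E : IdealExponent A.Z) (ed : EdgeDataOn p n (baseHike E)), E.IsStandard → 0 < (baseHike E).b →
    IsEdgeDataOn IsEdgeData (baseHike E) ed →
    𝒞 (baseHike E) (invmaxStratum ((baseHike E).sing ∩ S02Preliminaries.closedPoints A.Z) (invField (baseHike E) ed)) →
      ∃ Echeck : IdealExponent A.Z, IsCoreFocus S04CharAlgebra.pAlg (invInst (baseHike E) ed) (baseHike E) Echeck ∧
        ∀ x ∈ Echeck.sing, IsLCICutAt (⟨Echeck.sing, A.isClosed_sing Echeck⟩ : Closeds A.Z) x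

variable {𝒞 IsEdgeData}

/-- Antitonicity in the class. [folklore] -/
theorem coreFocusSingLCIOn_mono {𝒟 : ∀ ⦃W : Scheme.{u}⦄, IdealExponent W → Set W → Prop}
    (hle : ∀ ⦃W⦄ (F : IdealExponent W) (S : Set W), 𝒞 F S → 𝒟 F S) {p : ℕ} [Fact p.Prime] {K : Type u} [Field K] [CharP K p]
    [PerfectField K] {A : AmbientDatum p K} {n : ℕ} (h : CoreFocusSingLCIOn 𝒟 IsEdgeData A n) : CoreFocusSingLCIOn 𝒞 IsEdgeData A n :=
  fun E ed hE hb hed hC => h E ed hE hb hed (hle _ _ hC)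

/-- Forget the A-type property: `CoreFocusSingLCIOn 𝒞 ⇒ CoreFocusExistsOn 𝒞` (p487786). [folklore] -/
theorem coreFocusExistsOn_of_coreFocusSingLCIOn {p : ℕ} [Fact p.Prime] {K : Type u} [Field K] [CharP K p] [PerfectField K]
    {A : AmbientDatum p K} {n : ℕ} (h : CoreFocusSingLCIOn 𝒞 IsEdgeData A n) : CoreFocusExistsOn 𝒞 IsEdgeData A n :=
  fun E ed hE hb hed hC => (h E ed hE hb hed hC).imp fun _ h' => h'.1

/-- **«`Ě` exists with A-type `Sing(Ě)`» on `𝒞` ⇒ every realized member of `𝒞` is in `LCIClass`** (§1, no hypothesis). [folklore] -/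
theorem lciClass_of_coreFocusSingLCIOn {p : ℕ} [Fact p.Prime] {K : Type u} [Field K] [CharP K p] [PerfectField K] {A : AmbientDatum p K}
    {n : ℕ} (h : CoreFocusSingLCIOn 𝒞 IsEdgeData A n) (E : IdealExponent A.Z) (ed : EdgeDataOn p n (baseHike E)) (hE : E.IsStandard)
    (hb : 0 < (baseHike E).b) (hed : IsEdgeDataOn IsEdgeData (baseHike E) ed)
    (hC : 𝒞 (baseHike E) (invmaxStratum ((baseHike E).sing ∩ S02Preliminaries.closedPoints A.Z) (invField (baseHike E) ed))) :
    LCIClass (baseHike E) (invmaxStratum ((baseHike E).sing ∩ S02Preliminaries.closedPoints A.Z) (invField (baseHike E) ed)) := by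
  obtain ⟨Echeck, hEc, hci⟩ := h E ed hE hb hed hC
  exact (lciClass_iff_forall_isLCICutAt_sing_of_isCoreFocus A (invInst (baseHike E) ed) (baseHike E) hEc).mpr hci

/-- **Existence alone suffices inside `LCIClass`**: if every realized member of `𝒞` is A-type and `Ě` exists on `𝒞` (`CoreFocusExistsOn 𝒞`), then
`CoreFocusSingLCIOn 𝒞` (§1 transports the class guard to `Sing(Ě)`). [folklore] -/
theorem coreFocusSingLCIOn_of_coreFocusExistsOn {p : ℕ} [Fact p.Prime] {K : Type u} [Field K] [CharP K p] [PerfectField K]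
    {A : AmbientDatum p K} {n : ℕ} (h : CoreFocusExistsOn 𝒞 IsEdgeData A n)
    (hle : ∀ (E : IdealExponent A.Z) (ed : EdgeDataOn p n (baseHike E)), E.IsStandard → 0 < (baseHike E).b →
      IsEdgeDataOn IsEdgeData (baseHike E) ed →
      𝒞 (baseHike E) (invmaxStratum ((baseHike E).sing ∩ S02Preliminaries.closedPoints A.Z) (invField (baseHike E) ed)) →
        LCIClass (baseHike E) (invmaxStratum ((baseHike E).sing ∩ S02Preliminaries.closedPoints A.Z) (invField (baseHike E) ed))) :
    CoreFocusSingLCIOn 𝒞 IsEdgeData A n := by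
  intro E ed hE hb hed hC
  obtain ⟨Echeck, hEc⟩ := h E ed hE hb hed hC
  exact ⟨Echeck, hEc,
    (lciClass_iff_forall_isLCICutAt_sing_of_isCoreFocus A (invInst (baseHike E) ed) (baseHike E) hEc).mp (hle E ed hE hb hed hC)⟩

/-- **On `LCIClass` itself**: the W3.6 A-type apex `CoreFocusExistsOn LCIClass` (p487786/p488503; PROVED at the `p`-slice, p491140) gives
`CoreFocusSingLCIOn LCIClass`. [folklore] -/
theorem coreFocusSingLCIOn_lci_of_coreFocusExistsOn {p : ℕ} [Fact p.Prime] {K : Type u} [Field K] [CharP K p] [PerfectField K]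
    {A : AmbientDatum p K} {n : ℕ} (h : CoreFocusExistsOn LCIClass IsEdgeData A n) : CoreFocusSingLCIOn LCIClass IsEdgeData A n :=
  coreFocusSingLCIOn_of_coreFocusExistsOn h fun _ _ _ _ _ hC => hC

/-- **⟨SingRegular⟩ ⇒ ⟨SingLCI⟩ on every class** (p498576's `CoreFocusSingRegularOn 𝒞` ⇒ `CoreFocusSingLCIOn 𝒞`): a regular `Sing(Ě) = Σ̄_max` is an
l.c.i. cut at each of its points — res-type-012's K-3a `lciClass_of_invmaxClosureRegularOn` (p497030) read through p498576 §1 and §1 here. [folklore] -/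
theorem coreFocusSingLCIOn_of_coreFocusSingRegularOn {p : ℕ} [Fact p.Prime] {K : Type u} [Field K] [CharP K p] [PerfectField K]
    {A : AmbientDatum p K} {n : ℕ} (h : CoreFocusSingRegularOn 𝒞 IsEdgeData A n) : CoreFocusSingLCIOn 𝒞 IsEdgeData A n := by
  intro E ed hE hb hed hC
  obtain ⟨Echeck, hEc, hreg⟩ := h E ed hE hb hed hC
  have hR : CampaignW31.InvmaxClosureRegularOn ((baseHike E).sing ∩ S02Preliminaries.closedPoints A.Z) (invField (baseHike E) ed) :=
    (CampaignW31.invmaxClosureRegularOn_iff_isRegular_sing_of_isCoreFocus A (invInst (baseHike E) ed) (baseHike E) hEc).mpr hreg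
  exact ⟨Echeck, hEc, (lciClass_iff_forall_isLCICutAt_sing_of_isCoreFocus A (invInst (baseHike E) ed) (baseHike E) hEc).mp
    (lciClass_of_invmaxClosureRegularOn A (baseHike E) _ _ hR)⟩

/-- **THE TWO D-KERNELS FIRE ON THE CLASS**: `CoreFocusSingLCIOn 𝒞` ⇒ for every realized member of `𝒞` there is a typed core focus `Ě` with
`Eq56_prod_ours A Ě V ∧ Thm6_14_prop2_prod_ours A Ě V` for EVERY affine open `V` (p496819 / p497160 BY NAME). [folklore] -/
theorem eq56_thm614prop2_of_coreFocusSingLCIOn {p : ℕ} [Fact p.Prime] {K : Type u} [Field K] [CharP K p] [PerfectField K]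
    {A : AmbientDatum p K} {n : ℕ} (h : CoreFocusSingLCIOn 𝒞 IsEdgeData A n) (E : IdealExponent A.Z) (ed : EdgeDataOn p n (baseHike E))
    (hE : E.IsStandard) (hb : 0 < (baseHike E).b) (hed : IsEdgeDataOn IsEdgeData (baseHike E) ed)
    (hC : 𝒞 (baseHike E) (invmaxStratum ((baseHike E).sing ∩ S02Preliminaries.closedPoints A.Z) (invField (baseHike E) ed))) :
    ∃ Echeck : IdealExponent A.Z, IsCoreFocus S04CharAlgebra.pAlg (invInst (baseHike E) ed) (baseHike E) Echeck ∧
      ∀ V : A.Z.affineOpens, Eq56_prod_ours A Echeck V ∧ Thm6_14_prop2_prod_ours A Echeck V := by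
  obtain ⟨Echeck, hEc, hci⟩ := h E ed hE hb hed hC
  exact ⟨Echeck, hEc, fun V =>
    ⟨Eq56_prod_ours_of_isCoreFocus_of_lciRegular A (invInst (baseHike E) ed) (baseHike E) hb hEc hci V,
      Thm6_14_prop2_prod_ours_of_isCoreFocus_of_lciRegular A (invInst (baseHike E) ed) (baseHike E) hb hEc hci V⟩⟩

end OnClass

end CampaignW36

/-! ## 3. Per-`p` slice at `CampaignW31.edgeDataProvenance`; UNCONDITIONAL theorems on `LCIClass` and `RegularClosureClass` -/

open CampaignW36

/-- **[OURS · L1 W3.6 ↔ R20 20c/(2″)] `CampaignW36CoreFocusSingLCIOnI 𝒞 p`** — `p`-slice of «on the class `𝒞` the (43)-object `Ě` EXISTS and `Sing(Ě)` is an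
l.c.i. cut at each of its points» at `CampaignW31.edgeDataProvenance`. Replaces the role of p.30 l.5–9 on the class together with the unprinted A-type
premise of the (56″)/(2″) kernels; a HYPOTHESIS row over the class (refutable by one member whose `Σ̄_max` is not an l.c.i. cut); HOLDS on `LCIClass`
(`campaignW36CoreFocusSingLCIOnI_lci_holds`); NOT a statement of the manuscript. [folklore] -/
def CampaignW36CoreFocusSingLCIOnI (𝒞 : ∀ ⦃W : Scheme.{u}⦄, IdealExponent W → Set W → Prop) (p : ℕ) [Fact p.Prime] : Prop :=
  ∀ (K : Type u) [Field K] [CharP K p] [PerfectField K] (A : AmbientDatum p K) (n : ℕ),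
    CoreFocusSingLCIOn 𝒞 CampaignW31.edgeDataProvenance A n

/-- ⟨SingRegular⟩ ⇒ ⟨SingLCI⟩, `p`-slices (p498576's `CampaignW36CoreFocusSingRegularOnI 𝒞 p` ⇒ this file's). [folklore] -/
theorem campaignW36CoreFocusSingLCIOnI_of_singRegularOnI (𝒞 : ∀ ⦃W : Scheme.{u}⦄, IdealExponent W → Set W → Prop) (p : ℕ) [Fact p.Prime]
    (h : CampaignW36CoreFocusSingRegularOnI.{u} 𝒞 p) : CampaignW36CoreFocusSingLCIOnI.{u} 𝒞 p :=
  fun K _ _ _ A n => coreFocusSingLCIOn_of_coreFocusSingRegularOn (h K A n)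

/-- The `p`-slice gives the W3.6 apex slice `CampaignW36CoreFocusExistsOnI 𝒞 p` (p487786). [folklore] -/
theorem campaignW36CoreFocusExistsOnI_of_coreFocusSingLCIOnI (𝒞 : ∀ ⦃W : Scheme.{u}⦄, IdealExponent W → Set W → Prop) (p : ℕ) [Fact p.Prime]
    (h : CampaignW36CoreFocusSingLCIOnI.{u} 𝒞 p) : CampaignW36CoreFocusExistsOnI.{u} 𝒞 p :=
  fun K _ _ _ A n => coreFocusExistsOn_of_coreFocusSingLCIOn (h K A n)

/-- **[OURS · L1 W3.6, UNCONDITIONAL] on the A-type class `LCIClass` the (43)-object EXISTS with A-type `Sing(Ě)`**: `CampaignW36CoreFocusSingLCIOnI LCIClass p`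
for every prime `p` — the A-type door `campaignW36CoreFocusExists_lci_holds` (p491140, over T-A p490274 and the W3.1 slot statement) + §1. NOT a statement of
the manuscript. [folklore] -/
theorem campaignW36CoreFocusSingLCIOnI_lci_holds (p : ℕ) [Fact p.Prime] : CampaignW36CoreFocusSingLCIOnI.{u} LCIClass p :=
  fun K _ _ _ A n => coreFocusSingLCIOn_lci_of_coreFocusExistsOn (campaignW36CoreFocusExists_lci_holds p K A n)

/-- **[OURS · L1 W3.1/W3.6, UNCONDITIONAL] on the class of REGULAR top strata** (`RegularClosureClass`, p498576): `CampaignW36CoreFocusSingLCIOnI RegularClosureClass p`.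
[folklore] -/
theorem campaignW36CoreFocusSingLCIOnI_regularClosure_holds (p : ℕ) [Fact p.Prime] :
    CampaignW36CoreFocusSingLCIOnI.{u} RegularClosureClass p :=
  campaignW36CoreFocusSingLCIOnI_of_singRegularOnI _ p (campaignW36CoreFocusSingRegularOnI_regularClosure_holds p)

/-- **[OURS · L1 W3.6 ↔ R20 20c/(2″), UNCONDITIONAL — THE HEADLINE]** for every prime `p`, perfect `K` of characteristic `p`, ambient datum `A`, `n`,
STANDARD `E` on `A.Z` with `0 < Ê.b` (`Ê = baseHike E`), every certified family `ed` of Def. 4.9 edge data of `Ê` on `Sing(Ê)_cl` whose `Inv_max`-stratum is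
A-TYPE (`LCIClass Ê Σ_max`): THERE IS a typed core focusing `Ě` of `Ê` (`IsCoreFocus ℘ (invInst Ê ed) Ê Ě`, row 010d) such that for EVERY affine open
`V`, `Eq56_prod_ours A Ě V` (the OURS product reading (56″) of Eq. (56)) AND `Thm6_14_prop2_prod_ours A Ě V` (Th. 6.14 (2) over (56″)). So, at the
(43)-object, GAP-LEDGER 20c|(56″) and Th. 6.14 (2″) FOLLOW OUTRIGHT on `LCIClass`-data (binder-free), while 20a (Th. 6.14 (1)) does so on
`RegularClosureClass`-data (p498576) — SEAT 1 (s36-pv-3) is to separate the two INSIDE `LCIClass`. Composition of p491140 · p496819 · p497160 · p498576;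
NOT a statement of the manuscript and not the printed «∩» sentences. [folklore] -/
theorem campaignW36_eq56_thm614prop2_lci_holds (p : ℕ) [Fact p.Prime] (K : Type u) [Field K] [CharP K p] [PerfectField K]
    (A : AmbientDatum p K) (n : ℕ) (E : IdealExponent A.Z) (ed : EdgeDataOn p n (baseHike E)) (hE : E.IsStandard) (hb : 0 < (baseHike E).b)
    (hed : IsEdgeDataOn CampaignW31.edgeDataProvenance (baseHike E) ed)
    (hC : LCIClass (baseHike E) (invmaxStratum ((baseHike E).sing ∩ S02Preliminaries.closedPoints A.Z) (invField (baseHike E) ed))) :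
    ∃ Echeck : IdealExponent A.Z, IsCoreFocus S04CharAlgebra.pAlg (invInst (baseHike E) ed) (baseHike E) Echeck ∧
      ∀ V : A.Z.affineOpens, Eq56_prod_ours A Echeck V ∧ Thm6_14_prop2_prod_ours A Echeck V :=
  eq56_thm614prop2_of_coreFocusSingLCIOn (campaignW36CoreFocusSingLCIOnI_lci_holds p K A n) E ed hE hb hed hC

/-- **… and for EVERY typed core focus, not only the produced one** (instantiation of record `IsCoreFocus_inst Ê Ě ed`): on `LCIClass`-data each `Ě` satisfies
(56″) ∧ Th. 6.14 (2″) on every affine open; only `0 < Ê.b` is used (no standardness / certification). [folklore] -/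
theorem eq56_thm614prop2_of_lciClass_inst {p : ℕ} [Fact p.Prime] {K : Type u} [Field K] [CharP K p] (A : AmbientDatum p K) {n : ℕ}
    (E : IdealExponent A.Z) (ed : EdgeDataOn p n (baseHike E)) (hb : 0 < (baseHike E).b)
    (hC : LCIClass (baseHike E) (invmaxStratum ((baseHike E).sing ∩ S02Preliminaries.closedPoints A.Z) (invField (baseHike E) ed)))
    {Echeck : IdealExponent A.Z} (hEc : IsCoreFocus_inst (baseHike E) Echeck ed) (V : A.Z.affineOpens) :
    Eq56_prod_ours A Echeck V ∧ Thm6_14_prop2_prod_ours A Echeck V :=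
  ⟨eq56_prod_ours_of_lciClass A (invInst (baseHike E) ed) (baseHike E) hb hC hEc V,
    thm6_14_prop2_prod_ours_of_lciClass A (invInst (baseHike E) ed) (baseHike E) hb hC hEc V⟩

end Summit.ResolutionOfSingularities.ResolutionOfSingularities.Theorems

end
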